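import Literature.MathematicalPhysics.QuantumFieldTheory.Balaban1983to89.T4ShellMeasurePolar

/-!
# `Balaban1983to89.T4ShellMeasureTwoSpeed` — node U5b, cell input NE7c, SHELL-MEASURE ROUTE: the TWO-SPEED
dilation presentation in kernel (flat block at clock speed `e^{−r}`, harmonic/toron block at `e^{−r/2}` — the rays of
member (γ‴)); the fibre Jacobian constant `n_fl + n_h/2` is a THEOREM; (TS)'s measure-theoretic half DISCHARGED

(cell `pub-balaban`, T4-DAG v22 §6 row NE7c, fan-out seat `b2b-balaban-t4-ne7c-p1` gen 8, design row
T4-U5b.E2-NE7c-PROVE-P1i*; Mathlib + `T4ShellMeasurePolar` only; companion record `t4/T4-EST-NE7c-P1.md` §3 ((γ″) POLAR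
ADDENDUM, two-speed reading) / §4 ((TS), (DC-fwd)); v1.)

WHAT THIS LEAF IS FOR.  `T4ShellMeasurePolar` (v1) put the ONE-SPEED dilation presentation `x = e^{−r} ŷ` of a
Haar-with-density measure `μ.withDensity f` in kernel (`map_logPolar_withDensity`) and with it discharged the
presentation binders `(e, he, ν, F, u′)` of the fibred members (γ′)/(γ″) — (SS′) reduced to same-space shell domination
+ a mass ratio `M`, (DC-fwd) `= n + B_f`.  The toron-band member (γ‴) (`T4ShellMeasureToron` §4, clock `z = e^{−r/m}`,
`m = 2`) lives on TWO-SPEED rays: on a background whose linearised curvature map has a kernel (the harmonic /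
toron block `E_h`), the plaquette variable is LINEAR in the flat-block coordinates `a ∈ E_fl` and QUADRATIC in the
harmonic coordinates `w ∈ E_h`, so the ray along which it scales like `e^{−r}` moves `a` at speed `e^{−r}` and `w` at
speed `e^{−r/2}`.  Its presentation (TS) was a LOCATED CONSTRUCTION binder, with the READING (record v1.9/v2.0)
«conjugating by the radial squaring of the harmonic block, (DC-fwd) becomes `B = n_fl + n_h/2 + B_f`».  THIS LEAF
makes that reading a theorem, by an argument that never leaves Mathlib + v1: write each block in v1's log-polar
coordinates `(σ_fl, r_fl)`, `(σ_h, r_h)`; the two-speed flow is the translation `(r_fl, r_h) ↦ (r_fl + t, r_h + t/2)`;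
the SHEAR `r = r_fl`, `q = r_h − r_fl/2` (a ray invariant) has unit Jacobian (translation invariance of Lebesgue measure
in `r_h` at fixed `r_fl`), and `e^{−n_fl r_fl} e^{−n_h r_h} = e^{−n_h q} · e^{−(n_fl + n_h/2) r}`.

CONTENT (all [folklore]; finite-dimensional real normed spaces `E₁` (flat block, `dim = n₁ ≥ 1`) and `E₂` (harmonic
block, `dim = n₂ ≥ 1`) with additive Haar measures `μ₁`, `μ₂`; every proof from Mathlib + `T4ShellMeasurePolar`):
 §1 `dilate₂ (((σ₁, σ₂), q), r) = (e^{−r} σ₁, e^{−(r/2 + q)} σ₂)`, `logPolar₂` (a LEFT INVERSE situation on ALL of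
    `E₁ × E₂`: `dilate₂ ∘ logPolar₂ = id`, no exceptional set), the direction law
    `dirMeasure₂ μ₁ μ₂ n₂ = dirMeasure μ₁ ⊗ dirMeasure μ₂ ⊗ e^{−n₂ q} dq` on `Y = (E₁ × E₂) × ℝ`, the two-speed density
    `polarDensity₂ n₁ n₂ f ((σ, q), r) = e^{−(n₁ + n₂/2) r} f (dilate₂ ((σ, q), r))` on unit directions, the change of
    variables `lintegral_eq_lintegral_logPolar₂` and THE IDENTITY
    `map_logPolar₂_withDensity : ((μ₁.prod μ₂).withDensity f).map logPolar₂
        = ((dirMeasure₂ μ₁ μ₂ n₂).prod volume).withDensity (polarDensity₂ n₁ n₂ f)`;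
 §2 the member's consequences exactly as in v1 §2: `slotAntiConcentration_withDensity₂` ((M1) on `E₁ × E₂` itself from
    the per-fibre alternative on unit two-speed directions), `slot_field_of_logPolar₂` (end-to-end ⇒
    `T4ShellMeasure.slot_field_of_antiConcentration` BY NAME; residual (SS′) = same-space shell domination + mass
    ratio `M`), `slot_field_of_density₂` (`M = 1`);
 §3 (DC-fwd) on two-speed rays: `fwdLogLipschitzOn_polarDensity₂` — ray weight forward log-Lipschitz with `B_f`
    ⇒ `polarDensity₂` forward log-Lipschitz with `(n₁ + n₂/2) + B_f` (`T4ShellMeasureAnalytic.fwdLogLipschitzOn_polarJacobian`);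
    `fibreAlternative_polarDensity₂` transports the per-fibre alternative;
 §4 non-vacuity: the identity and the member instantiated on `ℝ × ℝ` (`n₁ = n₂ = 1`, fibre factor `e^{−(3/2) r}`) with a
    Gaussian density; `dilate₂ ∘ logPolar₂ = id` checked at the origin and on the pure-toron axis `{a = 0}`.

HONEST FRAMING.  Rung (B)+1 only, finite `T⁴`; NOT infinite volume, NOT a mass gap, NOT Clay; NOT summit progress.  What
this leaf discharges of (TS) is its MEASURE-THEORETIC half (the push-forward identity with the exact Jacobian constant);
what stays located is geometric: the chart of the live-level configuration space near a toron background as a product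
`E_fl × E_h` carrying a Haar-with-density measure, the choice of centre (nearest flat connection), and the per-fibre
inputs of (γ‴) ((AN-inst₂), (SM₂) — `T4ShellMeasureToron` §4), plus the residual (SS′) numbers (domination, mass
ratio `M`), the ray constant `B_f`, (W1), (F∞)-rate — GAPS G-ne7cp1-13 ⟦UPDATE⟧, G-ne7cp1-7a, G-ne7cp1-10b.
ABSOLUTE RULE.  No internally-minted statement is a cited fact; every hypothesis is a binder; nothing of
[Balaban 1983–89] is instantiated or quoted as authority; all docstrings [folklore]; 0 sorry.

(value: bookkeeping — the two-speed Jacobian constant `n_fl + n_h/2` and the transversal weight `e^{−n_h q}` are now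
kernel facts rather than a reading, so a consumer of (γ‴) owes for the presentation only the chart and the centre; no
new estimate about densities.  NOT summit progress.)
-/

namespace Literature.MathematicalPhysics.QuantumFieldTheory.Balaban1983to89.T4ShellMeasureTwoSpeed

open MeasureTheory Set Metric Function
open scoped NNReal ENNReal

open Literature.MathematicalPhysics.QuantumFieldTheory.Balaban1983to89.T4ShellMeasure
open Literature.MathematicalPhysics.QuantumFieldTheory.Balaban1983to89.T4ShellMeasureFibre
open Literature.MathematicalPhysics.QuantumFieldTheory.Balaban1983to89.T4ShellMeasureAnalytic
open Literature.MathematicalPhysics.QuantumFieldTheory.Balaban1983to89.T4ShellMeasurePolar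

/-! ## §1 The two-speed dilation presentation and the push-forward identity -/

section Presentation

variable {E₁ E₂ : Type*} [NormedAddCommGroup E₁] [NormedSpace ℝ E₁] [NormedAddCommGroup E₂] [NormedSpace ℝ E₂]

/-- THE TWO-SPEED RAY: the point at clock `r` with direction data `((σ₁, σ₂), q)` — flat block `e^{−r} σ₁` (speed
`e^{−r}`), harmonic block `e^{−(r/2 + q)} σ₂` (speed `e^{−r/2}`, transversal offset `q`); built from v1's one-speed
`dilate` on each block. [folklore] -/
noncomputable def dilate₂ (p : ((E₁ × E₂) × ℝ) × ℝ) : E₁ × E₂ :=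
  (dilate (p.1.1.1, p.2), dilate (p.1.1.2, p.2 / 2 + p.1.2))

/-- `dilate₂ (((σ₁, σ₂), q), r) = (e^{−r} σ₁, e^{−(r/2 + q)} σ₂)`. [folklore] -/
@[simp] theorem dilate₂_apply (σ₁ : E₁) (σ₂ : E₂) (q r : ℝ) :
    dilate₂ (((σ₁, σ₂), q), r) = (Real.exp (-r) • σ₁, Real.exp (-(r / 2 + q)) • σ₂) := rfl

/-- THE TWO-SPEED PRESENTATION MAP: unit directions of both blocks, the ray invariant `q = r_h − r_fl/2`, and the
clock `r = r_fl = −log ‖a‖` (`r_h = −log ‖w‖`); junk values at `a = 0` or `w = 0` are harmless (`dilate₂ ∘ logPolar₂ = id`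
holds everywhere, `dilate₂_logPolar₂`, and `{a = 0} ∪ {w = 0}` is Haar-null). [folklore] -/
noncomputable def logPolar₂ (x : E₁ × E₂) : ((E₁ × E₂) × ℝ) × ℝ :=
  ((((logPolar x.1).1, (logPolar x.2).1), (logPolar x.2).2 - (logPolar x.1).2 / 2), (logPolar x.1).2)

/-- the presentation map in coordinates. [folklore] -/
theorem logPolar₂_apply (a : E₁) (w : E₂) :
    logPolar₂ (a, w) = (((‖a‖⁻¹ • a, ‖w‖⁻¹ • w), -Real.log ‖w‖ - -Real.log ‖a‖ / 2), -Real.log ‖a‖) := rfl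

/-- `dilate₂ ∘ logPolar₂ = id` on ALL of `E₁ × E₂` (no exceptional point). [folklore] -/
theorem dilate₂_logPolar₂ (x : E₁ × E₂) : dilate₂ (logPolar₂ x) = x := by
  obtain ⟨a, w⟩ := x
  have h : (logPolar a).2 / 2 + ((logPolar w).2 - (logPolar a).2 / 2) = (logPolar w).2 := by ring
  show (dilate ((logPolar a).1, (logPolar a).2),
      dilate ((logPolar w).1, (logPolar a).2 / 2 + ((logPolar w).2 - (logPolar a).2 / 2))) = (a, w)
  rw [h, Prod.mk.eta, Prod.mk.eta, dilate_logPolar, dilate_logPolar]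

/-- hence a tested variable `u` on `E₁ × E₂` is the pull-back of its presentation `u ∘ dilate₂`. [folklore] -/
theorem comp_dilate₂_comp_logPolar₂ {α : Type*} (g : E₁ × E₂ → α) : (g ∘ dilate₂) ∘ logPolar₂ = g :=
  funext fun x => congrArg g (dilate₂_logPolar₂ x)

/-- `logPolar₂ ∘ dilate₂ = id` on unit directions. [folklore] -/
theorem logPolar₂_dilate₂ {σ₁ : E₁} {σ₂ : E₂} (h₁ : ‖σ₁‖ = 1) (h₂ : ‖σ₂‖ = 1) (q r : ℝ) :
    logPolar₂ (dilate₂ (((σ₁, σ₂), q), r)) = (((σ₁, σ₂), q), r) := by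
  have h : r / 2 + q - r / 2 = q := by ring
  simp only [dilate₂_apply, logPolar₂, logPolar_exp_neg_smul h₁, logPolar_exp_neg_smul h₂, h]

/-- shells of `u` are the `logPolar₂`-preimages of the shells of its presentation `u ∘ dilate₂`. [folklore] -/
theorem preimage_logPolar₂_window (u : E₁ × E₂ → ℝ) (a b : ℝ) :
    logPolar₂ ⁻¹' {p | a ≤ (u ∘ dilate₂) p ∧ (u ∘ dilate₂) p < b} = {x | a ≤ u x ∧ u x < b} := by
  ext x
  simp only [mem_preimage, mem_setOf_eq, Function.comp_apply, dilate₂_logPolar₂]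

/-- `dilate₂` is continuous. [folklore] -/
theorem continuous_dilate₂ : Continuous (dilate₂ : ((E₁ × E₂) × ℝ) × ℝ → E₁ × E₂) :=
  (continuous_dilate.comp (continuous_fst.fst.fst.prodMk continuous_snd)).prodMk
    (continuous_dilate.comp (continuous_fst.fst.snd.prodMk
      ((continuous_snd.div_const 2).add continuous_fst.snd)))

/-- THE TWO-SPEED DENSITY of a density `f` on `E₁ × E₂` (`dim E₁ = n₁`, `dim E₂ = n₂`): fibre volume factor
`e^{−(n₁ + n₂/2) r}` times `f` along the two-speed ray, on unit directions of both blocks; zero elsewhere (those fibres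
are not charged by the direction law). [folklore] -/
noncomputable def polarDensity₂ (n₁ n₂ : ℝ) (f : E₁ × E₂ → ℝ≥0∞) : ((E₁ × E₂) × ℝ) × ℝ → ℝ≥0∞ :=
  (((sphere (0 : E₁) 1 ×ˢ sphere (0 : E₂) 1) ×ˢ (univ : Set ℝ)) ×ˢ (univ : Set ℝ)).indicator
    fun p => ENNReal.ofReal (Real.exp (-((n₁ + n₂ / 2) * p.2))) * f (dilate₂ p)

/-- the two-speed density on unit directions: `e^{−(n₁ + n₂/2) r} · f (dilate₂ ((σ, q), r))`. [folklore] -/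
theorem polarDensity₂_of_norm_eq_one {n₁ n₂ : ℝ} {f : E₁ × E₂ → ℝ≥0∞} {σ₁ : E₁} {σ₂ : E₂}
    (h₁ : ‖σ₁‖ = 1) (h₂ : ‖σ₂‖ = 1) (q r : ℝ) :
    polarDensity₂ n₁ n₂ f (((σ₁, σ₂), q), r) =
      ENNReal.ofReal (Real.exp (-((n₁ + n₂ / 2) * r))) * f (dilate₂ (((σ₁, σ₂), q), r)) := by
  have h : (((σ₁, σ₂), q), r) ∈
      ((sphere (0 : E₁) 1 ×ˢ sphere (0 : E₂) 1) ×ˢ (univ : Set ℝ)) ×ˢ (univ : Set ℝ) :=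
    ⟨⟨⟨mem_sphere_zero_iff_norm.2 h₁, mem_sphere_zero_iff_norm.2 h₂⟩, mem_univ _⟩, mem_univ _⟩
  simp only [polarDensity₂, indicator_of_mem h]

/-- the two-speed density vanishes unless BOTH directions are unit vectors. [folklore] -/
theorem polarDensity₂_of_not {n₁ n₂ : ℝ} {f : E₁ × E₂ → ℝ≥0∞} {σ₁ : E₁} {σ₂ : E₂}
    (h : ¬(‖σ₁‖ = 1 ∧ ‖σ₂‖ = 1)) (q r : ℝ) : polarDensity₂ n₁ n₂ f (((σ₁, σ₂), q), r) = 0 := by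
  have h' : (((σ₁, σ₂), q), r) ∉
      ((sphere (0 : E₁) 1 ×ˢ sphere (0 : E₂) 1) ×ˢ (univ : Set ℝ)) ×ˢ (univ : Set ℝ) :=
    fun hm => h ⟨mem_sphere_zero_iff_norm.1 hm.1.1.1, mem_sphere_zero_iff_norm.1 hm.1.1.2⟩
  simp only [polarDensity₂, indicator_of_notMem h']

/-- off unit directions every fibre is EXCEPTIONAL, so the per-fibre alternative of `T4ShellMeasureAnalytic` §2 need
only be asked on unit two-speed directions `((σ₁, σ₂), q)`, `‖σ₁‖ = ‖σ₂‖ = 1`. [folklore] -/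
theorem fibreAlternative_polarDensity₂_all {n₁ n₂ : ℝ} {f : E₁ × E₂ → ℝ≥0∞} {u' : ((E₁ × E₂) × ℝ) × ℝ → ℝ}
    {δ s B θ ρ L : ℝ}
    (hfib : ∀ (σ₁ : E₁) (σ₂ : E₂) (q : ℝ), ‖σ₁‖ = 1 → ‖σ₂‖ = 1 →
      FibreAlternative (polarDensity₂ n₁ n₂ f) u' δ s B θ ρ L ((σ₁, σ₂), q))
    (y : (E₁ × E₂) × ℝ) : FibreAlternative (polarDensity₂ n₁ n₂ f) u' δ s B θ ρ L y := by
  obtain ⟨⟨σ₁, σ₂⟩, q⟩ := y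
  by_cases h : ‖σ₁‖ = 1 ∧ ‖σ₂‖ = 1
  · exact hfib σ₁ σ₂ q h.1 h.2
  · exact Or.inl fun r _ => polarDensity₂_of_not h q r

/-- THE SHEAR IDENTITY for the block volume factors: `e^{−n₁ r} · e^{−n₂ (r/2 + q)} = e^{−n₂ q} · e^{−(n₁ + n₂/2) r}`.
[folklore] -/
theorem expWeight_shear (n₁ n₂ r q : ℝ) :
    ENNReal.ofReal (Real.exp (-(n₁ * r))) * ENNReal.ofReal (Real.exp (-(n₂ * (r / 2 + q)))) =
      ENNReal.ofReal (Real.exp (-(n₂ * q))) * ENNReal.ofReal (Real.exp (-((n₁ + n₂ / 2) * r))) := by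
  rw [← ENNReal.ofReal_mul (Real.exp_pos _).le, ← ENNReal.ofReal_mul (Real.exp_pos _).le, ← Real.exp_add,
    ← Real.exp_add]
  exact congrArg (fun t => ENNReal.ofReal (Real.exp t)) (by ring)

variable [MeasurableSpace E₁] [MeasurableSpace E₂]

/-- THE TWO-SPEED DIRECTION LAW on `Y = (E₁ × E₂) × ℝ`: the product of the two block direction laws (v1 `dirMeasure`)
with the transversal law `e^{−n₂ q} dq` of the ray invariant `q` (an s-finite, NOT finite, measure — harmless: the
members only need s-finiteness of the direction law). [folklore] -/
noncomputable def dirMeasure₂ (μ₁ : Measure E₁) (μ₂ : Measure E₂) (n₂ : ℝ) : Measure ((E₁ × E₂) × ℝ) :=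
  ((dirMeasure μ₁).prod (dirMeasure μ₂)).prod
    ((volume : Measure ℝ).withDensity fun q => ENNReal.ofReal (Real.exp (-(n₂ * q))))

variable [BorelSpace E₁] [BorelSpace E₂]

/-- `dilate₂` is measurable. [folklore] -/
theorem measurable_dilate₂ : Measurable (dilate₂ : ((E₁ × E₂) × ℝ) × ℝ → E₁ × E₂) :=
  (measurable_dilate.comp (measurable_fst.fst.fst.prodMk measurable_snd)).prodMk
    (measurable_dilate.comp (measurable_fst.fst.snd.prodMk
      ((measurable_snd.div_const 2).add measurable_fst.snd)))

/-- `logPolar₂` is measurable. [folklore] -/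
theorem measurable_logPolar₂ : Measurable (logPolar₂ : E₁ × E₂ → ((E₁ × E₂) × ℝ) × ℝ) :=
  ((((measurable_logPolar.comp measurable_fst).fst).prodMk ((measurable_logPolar.comp measurable_snd).fst)).prodMk
    (((measurable_logPolar.comp measurable_snd).snd).sub
      (((measurable_logPolar.comp measurable_fst).snd).div_const 2))).prodMk
    ((measurable_logPolar.comp measurable_fst).snd)

/-- the two-speed density of a measurable density is measurable. [folklore] -/
theorem measurable_polarDensity₂ (n₁ n₂ : ℝ) {f : E₁ × E₂ → ℝ≥0∞} (hf : Measurable f) :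
    Measurable (polarDensity₂ n₁ n₂ f) := by
  refine Measurable.indicator ?_
    (((isClosed_sphere.measurableSet.prod isClosed_sphere.measurableSet).prod MeasurableSet.univ).prod
      MeasurableSet.univ)
  exact (ENNReal.measurable_ofReal.comp (Real.measurable_exp.comp (measurable_const.mul measurable_snd).neg)).mul
    (hf.comp measurable_dilate₂)

/-- the ray integrals `y ↦ ∫ e^{−c r} H (dilate₂ (y, r)) dr` are measurable in the direction data. [folklore] -/
theorem measurable_lintegral_ray {H : E₁ × E₂ → ℝ≥0∞} (hH : Measurable H) (c : ℝ) :
    Measurable fun y : (E₁ × E₂) × ℝ =>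
      ∫⁻ r, ENNReal.ofReal (Real.exp (-(c * r))) * H (dilate₂ (y, r)) := by
  have hG : Measurable fun p : ((E₁ × E₂) × ℝ) × ℝ =>
      ENNReal.ofReal (Real.exp (-(c * p.2))) * H (dilate₂ p) :=
    (ENNReal.measurable_ofReal.comp (Real.measurable_exp.comp (measurable_const.mul measurable_snd).neg)).mul
      (hH.comp measurable_dilate₂)
  exact hG.lintegral_prod_right'

/-- the transversal weight is measurable. [folklore] -/
theorem measurable_qWeight (n₂ : ℝ) : Measurable fun q : ℝ => ENNReal.ofReal (Real.exp (-(n₂ * q))) :=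
  ENNReal.measurable_ofReal.comp (Real.measurable_exp.comp (measurable_const.mul measurable_id).neg)

variable [FiniteDimensional ℝ E₁] [FiniteDimensional ℝ E₂] (μ₁ : Measure E₁) (μ₂ : Measure E₂)
  [μ₁.IsAddHaarMeasure] [μ₂.IsAddHaarMeasure]

/-- the two-speed direction law is s-finite. [folklore] -/
instance sFinite_dirMeasure₂ (n₂ : ℝ) : SFinite (dirMeasure₂ μ₁ μ₂ n₂) := by
  unfold dirMeasure₂; infer_instance

omit [FiniteDimensional ℝ E₁] [μ₁.IsAddHaarMeasure] in
/-- integrals against the two-speed direction law, iterated: sphere of `E₁`, sphere of `E₂`, transversal line with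
weight `e^{−n₂ q}`. [folklore] -/
theorem lintegral_dirMeasure₂ (n₂ : ℝ) {G : (E₁ × E₂) × ℝ → ℝ≥0∞} (hG : Measurable G) :
    ∫⁻ y, G y ∂(dirMeasure₂ μ₁ μ₂ n₂) =
      ∫⁻ ω₁, ∫⁻ ω₂, (∫⁻ q, ENNReal.ofReal (Real.exp (-(n₂ * q))) * G (((ω₁ : E₁), (ω₂ : E₂)), q))
        ∂μ₂.toSphere ∂μ₁.toSphere := by
  rw [dirMeasure₂, lintegral_prod _ hG.aemeasurable, lintegral_prod _ hG.lintegral_prod_right'.aemeasurable,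
    lintegral_dirMeasure]
  refine lintegral_congr fun ω₁ => ?_
  rw [lintegral_dirMeasure]
  refine lintegral_congr fun ω₂ => ?_
  have hm : Measurable fun q : ℝ => G (((ω₁ : E₁), (ω₂ : E₂)), q) := hG.comp measurable_prodMk_left
  rw [lintegral_withDensity_eq_lintegral_mul _ (measurable_qWeight n₂) hm]
  rfl

variable [Nontrivial E₁] [Nontrivial E₂]

/-- **TWO-SPEED LOG-POLAR COORDINATES FOR LOWER LEBESGUE INTEGRALS.**  On `E₁ × E₂` (`dim E₁ = n₁ ≥ 1`,
`dim E₂ = n₂ ≥ 1`, additive Haar measures `μ₁`, `μ₂`):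
`∫ H d(μ₁ ⊗ μ₂) = ∫_{Y} ∫_ℝ e^{−(n₁ + n₂/2) r} H (dilate₂ (y, r)) dr d(dirMeasure₂)(y)`.
(v1's one-speed coordinates on each block, Tonelli, and the shear `r = r_fl`, `q = r_h − r_fl/2`: translation
invariance of Lebesgue measure in `r_h` and `expWeight_shear`.) [folklore] -/
theorem lintegral_eq_lintegral_logPolar₂ {H : E₁ × E₂ → ℝ≥0∞} (hH : Measurable H) :
    ∫⁻ x, H x ∂(μ₁.prod μ₂) =
      ∫⁻ y, (∫⁻ r, ENNReal.ofReal (Real.exp (-(((Module.finrank ℝ E₁ : ℝ) + (Module.finrank ℝ E₂ : ℝ) / 2) * r))) *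
        H (dilate₂ (y, r))) ∂(dirMeasure₂ μ₁ μ₂ (Module.finrank ℝ E₂)) := by
  -- one-speed coordinates on each block
  have hΦ : Measurable fun a : E₁ => ∫⁻ w, H (a, w) ∂μ₂ := hH.lintegral_prod_right'
  have hC : ∀ b : E₁, ∫⁻ w, H (b, w) ∂μ₂ =
      ∫⁻ σ₂, (∫⁻ r₂, ENNReal.ofReal (Real.exp (-((Module.finrank ℝ E₂ : ℝ) * r₂))) *
        H (b, Real.exp (-r₂) • σ₂)) ∂(dirMeasure μ₂) :=
    fun b => lintegral_eq_lintegral_logPolar μ₂ (hH.comp measurable_prodMk_left)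
  rw [lintegral_prod _ hH.aemeasurable, lintegral_eq_lintegral_logPolar μ₁ hΦ]
  simp_rw [hC]
  -- the right-hand side, iterated
  rw [lintegral_dirMeasure₂ μ₁ μ₂ _ (measurable_lintegral_ray hH _), lintegral_dirMeasure]
  refine lintegral_congr fun ω₁ => ?_
  -- abbreviations for the fixed flat direction
  set σ₁ : E₁ := (ω₁ : E₁) with hσ₁
  -- (E1) push the flat volume factor inside
  have hE1 : ∀ r₁ : ℝ,
      ENNReal.ofReal (Real.exp (-((Module.finrank ℝ E₁ : ℝ) * r₁))) *
          ∫⁻ σ₂, (∫⁻ r₂, ENNReal.ofReal (Real.exp (-((Module.finrank ℝ E₂ : ℝ) * r₂))) *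
            H (Real.exp (-r₁) • σ₁, Real.exp (-r₂) • σ₂)) ∂(dirMeasure μ₂) =
        ∫⁻ σ₂, (∫⁻ r₂, ENNReal.ofReal (Real.exp (-((Module.finrank ℝ E₁ : ℝ) * r₁))) *
          (ENNReal.ofReal (Real.exp (-((Module.finrank ℝ E₂ : ℝ) * r₂))) *
            H (Real.exp (-r₁) • σ₁, Real.exp (-r₂) • σ₂))) ∂(dirMeasure μ₂) := by
    intro r₁
    rw [← lintegral_const_mul' _ _ ENNReal.ofReal_ne_top]
    refine lintegral_congr fun σ₂ => ?_
    rw [← lintegral_const_mul' _ _ ENNReal.ofReal_ne_top]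
  simp_rw [hE1]
  -- (E2) swap the flat clock with the harmonic direction
  have hm2 : Measurable fun p : ℝ × E₂ =>
      ∫⁻ r₂, ENNReal.ofReal (Real.exp (-((Module.finrank ℝ E₁ : ℝ) * p.1))) *
        (ENNReal.ofReal (Real.exp (-((Module.finrank ℝ E₂ : ℝ) * r₂))) *
          H (Real.exp (-p.1) • σ₁, Real.exp (-r₂) • p.2)) := by
    have hG : Measurable fun z : (ℝ × E₂) × ℝ =>
        ENNReal.ofReal (Real.exp (-((Module.finrank ℝ E₁ : ℝ) * z.1.1))) *
          (ENNReal.ofReal (Real.exp (-((Module.finrank ℝ E₂ : ℝ) * z.2))) *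
            H (Real.exp (-z.1.1) • σ₁, Real.exp (-z.2) • z.1.2)) := by
      refine (ENNReal.measurable_ofReal.comp
        (Real.measurable_exp.comp (measurable_const.mul measurable_fst.fst).neg)).mul
        ((ENNReal.measurable_ofReal.comp (Real.measurable_exp.comp (measurable_const.mul measurable_snd).neg)).mul
          (hH.comp ?_))
      exact ((Real.measurable_exp.comp measurable_fst.fst.neg).smul measurable_const).prodMk
        ((Real.measurable_exp.comp measurable_snd.neg).smul measurable_fst.snd)
    exact hG.lintegral_prod_right'
  rw [lintegral_lintegral_swap hm2.aemeasurable, lintegral_dirMeasure]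
  refine lintegral_congr fun ω₂ => ?_
  set σ₂ : E₂ := (ω₂ : E₂) with hσ₂
  -- (E3) the shear `r_h = r/2 + q` at fixed flat clock `r`, and the volume-factor identity
  have hE3 : ∀ r : ℝ,
      ∫⁻ r₂, ENNReal.ofReal (Real.exp (-((Module.finrank ℝ E₁ : ℝ) * r))) *
          (ENNReal.ofReal (Real.exp (-((Module.finrank ℝ E₂ : ℝ) * r₂))) *
            H (Real.exp (-r) • σ₁, Real.exp (-r₂) • σ₂)) =
        ∫⁻ q, ENNReal.ofReal (Real.exp (-((Module.finrank ℝ E₂ : ℝ) * q))) *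
          (ENNReal.ofReal (Real.exp (-(((Module.finrank ℝ E₁ : ℝ) + (Module.finrank ℝ E₂ : ℝ) / 2) * r))) *
            H (dilate₂ (((σ₁, σ₂), q), r))) := by
    intro r
    rw [← lintegral_add_left_eq_self (μ := (volume : Measure ℝ))
      (fun r₂ => ENNReal.ofReal (Real.exp (-((Module.finrank ℝ E₁ : ℝ) * r))) *
        (ENNReal.ofReal (Real.exp (-((Module.finrank ℝ E₂ : ℝ) * r₂))) *
          H (Real.exp (-r) • σ₁, Real.exp (-r₂) • σ₂))) (r / 2)]
    refine lintegral_congr fun q => ?_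
    rw [dilate₂_apply, ← mul_assoc, ← mul_assoc, expWeight_shear]
  simp_rw [hE3]
  -- (E4) swap the clock with the ray invariant, (E5) pull the transversal weight out
  have hm4 : Measurable fun p : ℝ × ℝ =>
      ENNReal.ofReal (Real.exp (-((Module.finrank ℝ E₂ : ℝ) * p.2))) *
        (ENNReal.ofReal (Real.exp (-(((Module.finrank ℝ E₁ : ℝ) + (Module.finrank ℝ E₂ : ℝ) / 2) * p.1))) *
          H (dilate₂ (((σ₁, σ₂), p.2), p.1))) := by
    refine (ENNReal.measurable_ofReal.comp
      (Real.measurable_exp.comp (measurable_const.mul measurable_snd).neg)).mul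
      ((ENNReal.measurable_ofReal.comp (Real.measurable_exp.comp (measurable_const.mul measurable_fst).neg)).mul
        (hH.comp (measurable_dilate₂.comp ?_)))
    exact ((measurable_const.prodMk measurable_snd).prodMk measurable_fst)
  rw [lintegral_lintegral_swap hm4.aemeasurable]
  refine lintegral_congr fun q => ?_
  rw [lintegral_const_mul' _ _ ENNReal.ofReal_ne_top]

/-- **THE TWO-SPEED PUSH-FORWARD IDENTITY.**  For every measurable density `f` on `E₁ × E₂`:
`((μ₁ ⊗ μ₂).withDensity f).map logPolar₂ = (dirMeasure₂ μ₁ μ₂ n₂ ⊗ Lebesgue).withDensity (polarDensity₂ n₁ n₂ f)` —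
the presentation data `(e, ν, F)` of the fibred members are, for the two-speed density model, THEOREMS:
`e = logPolar₂`, `ν = dirMeasure₂ μ₁ μ₂ n₂`, `F = polarDensity₂ n₁ n₂ f` with fibre volume factor `e^{−(n₁ + n₂/2) r}`.
[folklore] -/
theorem map_logPolar₂_withDensity {f : E₁ × E₂ → ℝ≥0∞} (hf : Measurable f) :
    ((μ₁.prod μ₂).withDensity f).map logPolar₂ =
      ((dirMeasure₂ μ₁ μ₂ (Module.finrank ℝ E₂)).prod (volume : Measure ℝ)).withDensity
        (polarDensity₂ (Module.finrank ℝ E₁) (Module.finrank ℝ E₂) f) := by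
  ext A hA
  have hpre : MeasurableSet (logPolar₂ ⁻¹' A) := measurable_logPolar₂ hA
  have hpd := measurable_polarDensity₂ (Module.finrank ℝ E₁ : ℝ) (Module.finrank ℝ E₂ : ℝ) hf
  rw [Measure.map_apply measurable_logPolar₂ hA, withDensity_apply _ hpre, ← lintegral_indicator hpre,
    lintegral_eq_lintegral_logPolar₂ μ₁ μ₂ (hf.indicator hpre), withDensity_apply _ hA, ← lintegral_indicator hA,
    lintegral_prod _ (hpd.indicator hA).aemeasurable,
    lintegral_dirMeasure₂ μ₁ μ₂ _ (measurable_lintegral_ray (hf.indicator hpre)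
      ((Module.finrank ℝ E₁ : ℝ) + (Module.finrank ℝ E₂ : ℝ) / 2)),
    lintegral_dirMeasure₂ μ₁ μ₂ _ (hpd.indicator hA).lintegral_prod_right']
  refine lintegral_congr fun ω₁ => lintegral_congr fun ω₂ => lintegral_congr fun q => ?_
  have h₁ : ‖(ω₁ : E₁)‖ = 1 := norm_eq_of_mem_sphere ω₁
  have h₂ : ‖(ω₂ : E₂)‖ = 1 := norm_eq_of_mem_sphere ω₂
  congr 1
  refine lintegral_congr fun r => ?_
  have hiff : dilate₂ ((((ω₁ : E₁), (ω₂ : E₂)), q), r) ∈ logPolar₂ ⁻¹' A ↔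
      ((((ω₁ : E₁), (ω₂ : E₂)), q), r) ∈ A := by
    rw [mem_preimage, logPolar₂_dilate₂ h₁ h₂]
  by_cases hmem : ((((ω₁ : E₁), (ω₂ : E₂)), q), r) ∈ A
  · rw [indicator_of_mem (hiff.2 hmem), indicator_of_mem hmem, polarDensity₂_of_norm_eq_one h₁ h₂]
  · rw [indicator_of_notMem (fun h => hmem (hiff.1 h)), indicator_of_notMem hmem, mul_zero]

/-- the identity evaluated on a measurable set of the presentation space. [folklore] -/
theorem withDensity_apply_preimage_logPolar₂ {f : E₁ × E₂ → ℝ≥0∞} (hf : Measurable f)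
    {A : Set (((E₁ × E₂) × ℝ) × ℝ)} (hA : MeasurableSet A) :
    ((μ₁.prod μ₂).withDensity f) (logPolar₂ ⁻¹' A) =
      ((dirMeasure₂ μ₁ μ₂ (Module.finrank ℝ E₂)).prod (volume : Measure ℝ)).withDensity
        (polarDensity₂ (Module.finrank ℝ E₁) (Module.finrank ℝ E₂) f) A := by
  rw [← map_logPolar₂_withDensity μ₁ μ₂ hf, Measure.map_apply measurable_logPolar₂ hA]

/-- TOTAL MASS is read off the two-speed presentation. [folklore] -/
theorem withDensity_univ_eq₂ {f : E₁ × E₂ → ℝ≥0∞} (hf : Measurable f) :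
    ((μ₁.prod μ₂).withDensity f) univ =
      ((dirMeasure₂ μ₁ μ₂ (Module.finrank ℝ E₂)).prod (volume : Measure ℝ)).withDensity
        (polarDensity₂ (Module.finrank ℝ E₁) (Module.finrank ℝ E₂) f) univ := by
  rw [← preimage_univ (f := (logPolar₂ : E₁ × E₂ → ((E₁ × E₂) × ℝ) × ℝ)),
    withDensity_apply_preimage_logPolar₂ μ₁ μ₂ hf MeasurableSet.univ]

/-- SHELL MASS is read off the two-speed presentation. [folklore] -/
theorem withDensity_window_eq₂ {f : E₁ × E₂ → ℝ≥0∞} (hf : Measurable f) {u : E₁ × E₂ → ℝ} (hu : Measurable u)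
    (a b : ℝ) :
    ((μ₁.prod μ₂).withDensity f) {x | a ≤ u x ∧ u x < b} =
      ((dirMeasure₂ μ₁ μ₂ (Module.finrank ℝ E₂)).prod (volume : Measure ℝ)).withDensity
        (polarDensity₂ (Module.finrank ℝ E₁) (Module.finrank ℝ E₂) f)
        {p | a ≤ (u ∘ dilate₂) p ∧ (u ∘ dilate₂) p < b} := by
  have hA : MeasurableSet {p : ((E₁ × E₂) × ℝ) × ℝ | a ≤ (u ∘ dilate₂) p ∧ (u ∘ dilate₂) p < b} :=
    (hu.comp measurable_dilate₂) measurableSet_Ico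
  rw [← preimage_logPolar₂_window u a b, withDensity_apply_preimage_logPolar₂ μ₁ μ₂ hf hA]

end Presentation

/-! ## §2 Consequences: (M1) on `E₁ × E₂` itself and the member's end-to-end with the two-speed presentation binders
discharged -/

section Member

variable {E₁ E₂ : Type*} [NormedAddCommGroup E₁] [NormedSpace ℝ E₁] [MeasurableSpace E₁] [BorelSpace E₁]
  [FiniteDimensional ℝ E₁] [Nontrivial E₁]
  [NormedAddCommGroup E₂] [NormedSpace ℝ E₂] [MeasurableSpace E₂] [BorelSpace E₂]
  [FiniteDimensional ℝ E₂] [Nontrivial E₂]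
  (μ₁ : Measure E₁) (μ₂ : Measure E₂) [μ₁.IsAddHaarMeasure] [μ₂.IsAddHaarMeasure]

/-- **(M1) ON THE CONFIGURATION SPACE `E₁ × E₂` ITSELF, for the two-speed density model.**  If on every unit
two-speed direction `((σ₁, σ₂), q)` the fibre `r ↦ polarDensity₂ n₁ n₂ f (((σ₁, σ₂), q), r)` and the presented variable
`u ∘ dilate₂` satisfy the per-fibre alternative of `T4ShellMeasureAnalytic` §2, then
`T4ShellMeasure.SlotAntiConcentration ((μ₁ ⊗ μ₂).withDensity f) u θ ρ (2·fibreCoef δ B ℓ₀ L)` — with NO presentation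
binder left (`slotAntiConcentration_of_fibreAlternative` for the fibred measure, the two-speed identity,
`slotAntiConcentration_comap` along `logPolar₂`, `(u ∘ dilate₂) ∘ logPolar₂ = u`). [folklore] -/
theorem slotAntiConcentration_withDensity₂ {f : E₁ × E₂ → ℝ≥0∞} (hf : Measurable f) {u : E₁ × E₂ → ℝ}
    (hu : Measurable u) {δ s B θ ρ ℓ₀ L : ℝ} (hδ0 : 0 ≤ δ) (hδ1 : δ < 1) (hB : 0 ≤ B) (hθ : 0 < θ) (hθs : θ ≤ s)
    (hρ0 : 0 ≤ ρ) (hρ2 : ρ ≤ 1 / 2) (hℓ₀ : -Real.log (1 - ρ) ≤ ℓ₀) (hlam : 0 < L / (1 + δ) - ℓ₀ / (1 - δ))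
    (hfib : ∀ (σ₁ : E₁) (σ₂ : E₂) (q : ℝ), ‖σ₁‖ = 1 → ‖σ₂‖ = 1 →
      FibreAlternative (polarDensity₂ (Module.finrank ℝ E₁) (Module.finrank ℝ E₂) f) (u ∘ dilate₂)
        δ s B θ ρ L ((σ₁, σ₂), q)) :
    SlotAntiConcentration ((μ₁.prod μ₂).withDensity f) u θ ρ (2 * fibreCoef δ B ℓ₀ L) := by
  have h := slotAntiConcentration_of_fibreAlternative (dirMeasure₂ μ₁ μ₂ (Module.finrank ℝ E₂))
    (measurable_polarDensity₂ _ _ hf) (hu.comp measurable_dilate₂) hδ0 hδ1 hB hθ hθs hρ0 hρ2 hℓ₀ hlam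
    (fibreAlternative_polarDensity₂_all hfib)
  rw [← map_logPolar₂_withDensity μ₁ μ₂ hf] at h
  have h2 := slotAntiConcentration_comap measurable_logPolar₂ h
  rwa [comp_dilate₂_comp_logPolar₂] at h2

/-- **THE (γ‴)-SHAPED MEMBER'S END-TO-END WITH THE TWO-SPEED PRESENTATION IN KERNEL.**  Data: the product
configuration space `E₁ × E₂` (flat block × harmonic block, both of dimension `≥ 1`) with additive Haar measures and
a measurable DOMINATING density `f`; the run's slot-summed-out measure `μrun` on the SAME space (finite); the tested
variable `u`; the per-fibre alternative for `polarDensity₂ n₁ n₂ f` and `u ∘ dilate₂` on unit two-speed directions;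
and the residual of (SS′) — DOMINATION ON THE SHELL and the MASS RATIO `M`.  Conclusion: the slot-ledger field
`Σ_τ piece τ ≤ (2·fibreCoef δ B ℓ₀ L·M·ρ)·Σ_τ A τ` via `T4ShellMeasure.slot_field_of_antiConcentration` BY NAME —
`T4ShellMeasureAnalytic.slot_field_of_fibreAlternative` with `(e, he, ν, F, u′)` INSTANTIATED by
`(logPolar₂, measurable_logPolar₂, dirMeasure₂ μ₁ μ₂ n₂, polarDensity₂ n₁ n₂ f, u ∘ dilate₂)`. [folklore] -/
theorem slot_field_of_logPolar₂ {ι : Type*} {f : E₁ × E₂ → ℝ≥0∞} (hf : Measurable f) {μrun : Measure (E₁ × E₂)}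
    [IsFiniteMeasure μrun] {u : E₁ × E₂ → ℝ} (hu : Measurable u)
    {δ s B θ ρ ℓ₀ L : ℝ} (hδ0 : 0 ≤ δ) (hδ1 : δ < 1) (hB : 0 ≤ B) (hθ : 0 < θ) (hθs : θ ≤ s)
    (hρ0 : 0 ≤ ρ) (hρ2 : ρ ≤ 1 / 2) (hℓ₀ : -Real.log (1 - ρ) ≤ ℓ₀) (hlam : 0 < L / (1 + δ) - ℓ₀ / (1 - δ))
    (hfib : ∀ (σ₁ : E₁) (σ₂ : E₂) (q : ℝ), ‖σ₁‖ = 1 → ‖σ₂‖ = 1 →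
      FibreAlternative (polarDensity₂ (Module.finrank ℝ E₁) (Module.finrank ℝ E₂) f) (u ∘ dilate₂)
        δ s B θ ρ L ((σ₁, σ₂), q))
    {M : ℝ} (hM : 0 ≤ M)
    (hS : μrun {x | θ * (1 - ρ) ≤ u x ∧ u x < θ} ≤
      ((μ₁.prod μ₂).withDensity f) {x | θ * (1 - ρ) ≤ u x ∧ u x < θ})
    (hmass : ((μ₁.prod μ₂).withDensity f) univ ≤ ENNReal.ofReal M * μrun univ)
    (T : Finset ι) {piece A : ι → ℝ} {Mw : ℝ} (hMw : 0 ≤ Mw)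
    (hpiece : ∑ τ ∈ T, piece τ ≤ Mw * (μrun {x | θ * (1 - ρ) ≤ u x ∧ u x < θ}).toReal)
    (hA : Mw * (μrun univ).toReal ≤ ∑ τ ∈ T, A τ) :
    ∑ τ ∈ T, piece τ ≤ (2 * fibreCoef δ B ℓ₀ L * M * ρ) * ∑ τ ∈ T, A τ := by
  have h1δ : 0 < 1 - δ := by linarith
  have hcoef : 0 ≤ fibreCoef δ B ℓ₀ L := by
    unfold fibreCoef
    exact div_nonneg (by positivity) (mul_pos h1δ hlam).le
  have hac := slotAntiConcentration_withDensity₂ μ₁ μ₂ hf hu hδ0 hδ1 hB hθ hθs hρ0 hρ2 hℓ₀ hlam hfib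
  have hdom := slotAntiConcentration_of_dominated (by positivity) hρ0 hS hac hmass
  exact slot_field_of_antiConcentration (by positivity) hρ0 hdom T hMw hpiece hA

/-- THE TWO-SPEED DENSITY MODEL ITSELF: for `μrun = (μ₁ ⊗ μ₂).withDensity f` (finite) the residual (SS′) binders hold
with EQUALITY and `M = 1`. [folklore] -/
theorem slot_field_of_density₂ {ι : Type*} {f : E₁ × E₂ → ℝ≥0∞} (hf : Measurable f)
    [IsFiniteMeasure ((μ₁.prod μ₂).withDensity f)] {u : E₁ × E₂ → ℝ} (hu : Measurable u)
    {δ s B θ ρ ℓ₀ L : ℝ} (hδ0 : 0 ≤ δ) (hδ1 : δ < 1) (hB : 0 ≤ B) (hθ : 0 < θ) (hθs : θ ≤ s)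
    (hρ0 : 0 ≤ ρ) (hρ2 : ρ ≤ 1 / 2) (hℓ₀ : -Real.log (1 - ρ) ≤ ℓ₀) (hlam : 0 < L / (1 + δ) - ℓ₀ / (1 - δ))
    (hfib : ∀ (σ₁ : E₁) (σ₂ : E₂) (q : ℝ), ‖σ₁‖ = 1 → ‖σ₂‖ = 1 →
      FibreAlternative (polarDensity₂ (Module.finrank ℝ E₁) (Module.finrank ℝ E₂) f) (u ∘ dilate₂)
        δ s B θ ρ L ((σ₁, σ₂), q))
    (T : Finset ι) {piece A : ι → ℝ} {Mw : ℝ} (hMw : 0 ≤ Mw)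
    (hpiece : ∑ τ ∈ T, piece τ ≤
      Mw * (((μ₁.prod μ₂).withDensity f) {x | θ * (1 - ρ) ≤ u x ∧ u x < θ}).toReal)
    (hA : Mw * (((μ₁.prod μ₂).withDensity f) univ).toReal ≤ ∑ τ ∈ T, A τ) :
    ∑ τ ∈ T, piece τ ≤ (2 * fibreCoef δ B ℓ₀ L * ρ) * ∑ τ ∈ T, A τ := by
  have h := slot_field_of_logPolar₂ μ₁ μ₂ hf hu hδ0 hδ1 hB hθ hθs hρ0 hρ2 hℓ₀ hlam hfib zero_le_one le_rfl
    (by rw [ENNReal.ofReal_one, one_mul]) T hMw hpiece hA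
  simpa only [mul_one] using h

/-- THE CO-TEST FORM of the residual (SS′) in the two-speed model: run integrand = dominating density × co-tests
`0 ≤ χ ≤ 1` ⇒ shell domination automatic, only the MASS RATIO `M` is owed. [folklore] -/
theorem slot_field_of_cotest₂ {ι : Type*} {f : E₁ × E₂ → ℝ≥0∞} (hf : Measurable f) {χ : E₁ × E₂ → ℝ≥0∞}
    (hχ1 : ∀ x, χ x ≤ 1) [IsFiniteMeasure ((μ₁.prod μ₂).withDensity fun x => f x * χ x)]
    {u : E₁ × E₂ → ℝ} (hu : Measurable u)
    {δ s B θ ρ ℓ₀ L : ℝ} (hδ0 : 0 ≤ δ) (hδ1 : δ < 1) (hB : 0 ≤ B) (hθ : 0 < θ) (hθs : θ ≤ s)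
    (hρ0 : 0 ≤ ρ) (hρ2 : ρ ≤ 1 / 2) (hℓ₀ : -Real.log (1 - ρ) ≤ ℓ₀) (hlam : 0 < L / (1 + δ) - ℓ₀ / (1 - δ))
    (hfib : ∀ (σ₁ : E₁) (σ₂ : E₂) (q : ℝ), ‖σ₁‖ = 1 → ‖σ₂‖ = 1 →
      FibreAlternative (polarDensity₂ (Module.finrank ℝ E₁) (Module.finrank ℝ E₂) f) (u ∘ dilate₂)
        δ s B θ ρ L ((σ₁, σ₂), q))
    {M : ℝ} (hM : 0 ≤ M)
    (hmass : ((μ₁.prod μ₂).withDensity f) univ ≤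
      ENNReal.ofReal M * ((μ₁.prod μ₂).withDensity fun x => f x * χ x) univ)
    (T : Finset ι) {piece A : ι → ℝ} {Mw : ℝ} (hMw : 0 ≤ Mw)
    (hpiece : ∑ τ ∈ T, piece τ ≤
      Mw * (((μ₁.prod μ₂).withDensity fun x => f x * χ x) {x | θ * (1 - ρ) ≤ u x ∧ u x < θ}).toReal)
    (hA : Mw * (((μ₁.prod μ₂).withDensity fun x => f x * χ x) univ).toReal ≤ ∑ τ ∈ T, A τ) :
    ∑ τ ∈ T, piece τ ≤ (2 * fibreCoef δ B ℓ₀ L * M * ρ) * ∑ τ ∈ T, A τ := by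
  have hle : ((μ₁.prod μ₂).withDensity fun x => f x * χ x) ≤ (μ₁.prod μ₂).withDensity f :=
    withDensity_mono (ae_of_all _ fun x => by
      calc f x * χ x ≤ f x * 1 := mul_le_mul_right (hχ1 x) (f x)
        _ = f x := mul_one _)
  exact slot_field_of_logPolar₂ μ₁ μ₂ hf hu hδ0 hδ1 hB hθ hθs hρ0 hρ2 hℓ₀ hlam hfib hM (hle _) hmass T hMw
    hpiece hA

end Member

/-! ## §3 (DC-fwd) on two-speed rays: `B = (n₁ + n₂/2) + B_f`, and the harmonic block's ray constant HALVES -/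

section Forward

variable {E₁ E₂ : Type*} [NormedAddCommGroup E₁] [NormedSpace ℝ E₁] [NormedAddCommGroup E₂] [NormedSpace ℝ E₂]

/-- **(DC-fwd) FOR THE TWO-SPEED DENSITY = `(n₁ + n₂/2) + B_f`.**  On a unit two-speed direction: if the ray weight
`r ↦ f (dilate₂ (((σ₁, σ₂), q), r))` is forward log-Lipschitz with constant `B_f` on `W`, the two-speed density is forward
log-Lipschitz with `(n₁ + n₂/2) + B_f` on `W` — the fibre volume factor `e^{−(n₁ + n₂/2) r}` is exactly log-Lipschitz
(`T4ShellMeasureAnalytic.fwdLogLipschitzOn_polarJacobian`) and constants add under products.  This is the v1.9/v2.0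
READING «B = n_fl + n_h/2 (+ ray constant)» of record §3 as a theorem. [folklore] -/
theorem fwdLogLipschitzOn_polarDensity₂ {n₁ n₂ Bf : ℝ} {f : E₁ × E₂ → ℝ≥0∞} {σ₁ : E₁} {σ₂ : E₂}
    (h₁ : ‖σ₁‖ = 1) (h₂ : ‖σ₂‖ = 1) (q : ℝ) {W : Set ℝ}
    (hf : FwdLogLipschitzOn (fun r => f (dilate₂ (((σ₁, σ₂), q), r))) Bf W) :
    FwdLogLipschitzOn (fun r => polarDensity₂ n₁ n₂ f (((σ₁, σ₂), q), r)) ((n₁ + n₂ / 2) + Bf) W := by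
  have h := (fwdLogLipschitzOn_polarJacobian (le_refl (n₁ + n₂ / 2)) W).mul hf
  intro r hr r' hr' hrr'
  dsimp only
  rw [polarDensity₂_of_norm_eq_one h₁ h₂, polarDensity₂_of_norm_eq_one h₁ h₂]
  exact h hr hr' hrr'

/-- the per-fibre alternative TRANSPORTS from the two-speed ray weight (constant `B_f`) to the two-speed density
(constant `(n₁ + n₂/2) + B_f`): same exceptional fibres, same proxy, same two-sidedness. [folklore] -/
theorem fibreAlternative_polarDensity₂ {n₁ n₂ Bf : ℝ} {f : E₁ × E₂ → ℝ≥0∞} {u : E₁ × E₂ → ℝ} {δ s θ ρ L : ℝ}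
    {σ₁ : E₁} {σ₂ : E₂} (h₁ : ‖σ₁‖ = 1) (h₂ : ‖σ₂‖ = 1) (q : ℝ)
    (h : FibreAlternative (fun p : ((E₁ × E₂) × ℝ) × ℝ => f (dilate₂ p)) (u ∘ dilate₂) δ s Bf θ ρ L ((σ₁, σ₂), q)) :
    FibreAlternative (polarDensity₂ n₁ n₂ f) (u ∘ dilate₂) δ s ((n₁ + n₂ / 2) + Bf) θ ρ L ((σ₁, σ₂), q) := by
  rcases h with h0 | ⟨v, hvm, hvpos, hincl, hts, hdc⟩
  · refine Or.inl fun r hr => ?_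
    have h1 : f (dilate₂ (((σ₁, σ₂), q), r)) = 0 := h0 r hr
    rw [polarDensity₂_of_norm_eq_one h₁ h₂, h1, mul_zero]
  · refine Or.inr ⟨v, hvm, hvpos, fun r hr => ?_, hts, fwdLogLipschitzOn_polarDensity₂ h₁ h₂ q hdc⟩
    rcases hincl r hr with h0 | hv
    · have h1 : f (dilate₂ (((σ₁, σ₂), q), r)) = 0 := h0
      exact Or.inl (by rw [polarDensity₂_of_norm_eq_one h₁ h₂, h1, mul_zero])
    · exact Or.inr hv

/-- HALF SPEED HALVES THE CONSTANT: a weight forward log-Lipschitz with constant `B` in its own one-speed clock is,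
read along the harmonic block's clock `r ↦ r/2 + q`, forward log-Lipschitz with constant `B/2` (on any set of clocks
mapped into `W`). [folklore] -/
theorem fwdLogLipschitzOn_halfSpeed {χ : ℝ → ℝ≥0∞} {B : ℝ} {W : Set ℝ} (h : FwdLogLipschitzOn χ B W) (q : ℝ)
    {W' : Set ℝ} (hW : ∀ r ∈ W', r / 2 + q ∈ W) :
    FwdLogLipschitzOn (fun r => χ (r / 2 + q)) (B / 2) W' := by
  intro r hr r' hr' hrr'
  have h1 := h (hW r hr) (hW r' hr') (by linarith)
  have h2 : B * (r' / 2 + q - (r / 2 + q)) = B / 2 * (r' - r) := by ring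
  rwa [h2] at h1

/-- **PRODUCT DENSITIES: the blocks' ray constants combine as `B_{f,1} + B_{f,2}/2`.**  For `f (a, w) = f₁ a · f₂ w`
(e.g. a Gaussian flat-block weight times the toron-block weight): if the flat ray weight `r ↦ f₁ (e^{−r} σ₁)` is forward
log-Lipschitz with `B₁` on `W` and the harmonic ray weight IN ITS OWN CLOCK `r ↦ f₂ (e^{−r} σ₂)` with `B₂` on `W₂`, then
the two-speed ray weight is forward log-Lipschitz with `B₁ + B₂/2` on `W ∩ {r | r/2 + q ∈ W₂}`; so v1's criteria (i)
(monotone ⇒ `0`) and (ii) (`𝒮′(z) ≥ −C z^m` on `(0, x₀]` ⇒ `C x₀^{m+1}`) apply BLOCKWISE. [folklore] -/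
theorem fwdLogLipschitzOn_ray₂_of_mul {f₁ : E₁ → ℝ≥0∞} {f₂ : E₂ → ℝ≥0∞} {B₁ B₂ : ℝ} {σ₁ : E₁} {σ₂ : E₂} (q : ℝ)
    {W W₂ : Set ℝ} (hf₁ : FwdLogLipschitzOn (fun r => f₁ (Real.exp (-r) • σ₁)) B₁ W)
    (hf₂ : FwdLogLipschitzOn (fun r => f₂ (Real.exp (-r) • σ₂)) B₂ W₂) :
    FwdLogLipschitzOn (fun r => (fun x : E₁ × E₂ => f₁ x.1 * f₂ x.2) (dilate₂ (((σ₁, σ₂), q), r)))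
      (B₁ + B₂ / 2) (W ∩ {r | r / 2 + q ∈ W₂}) := by
  have h := (hf₁.mono_set inter_subset_left).mul
    (fwdLogLipschitzOn_halfSpeed hf₂ q (W' := W ∩ {r | r / 2 + q ∈ W₂}) fun r hr => hr.2)
  intro r hr r' hr' hrr'
  simpa only [dilate₂_apply] using h hr hr' hrr'

/-- hence (DC-fwd) for the two-speed density of a product weight: `B = (n₁ + n₂/2) + B₁ + B₂/2`. [folklore] -/
theorem fwdLogLipschitzOn_polarDensity₂_of_mul {n₁ n₂ B₁ B₂ : ℝ} {f₁ : E₁ → ℝ≥0∞} {f₂ : E₂ → ℝ≥0∞}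
    {σ₁ : E₁} {σ₂ : E₂} (h₁ : ‖σ₁‖ = 1) (h₂ : ‖σ₂‖ = 1) (q : ℝ) {W W₂ : Set ℝ}
    (hf₁ : FwdLogLipschitzOn (fun r => f₁ (Real.exp (-r) • σ₁)) B₁ W)
    (hf₂ : FwdLogLipschitzOn (fun r => f₂ (Real.exp (-r) • σ₂)) B₂ W₂) :
    FwdLogLipschitzOn (fun r => polarDensity₂ n₁ n₂ (fun x : E₁ × E₂ => f₁ x.1 * f₂ x.2) (((σ₁, σ₂), q), r))
      ((n₁ + n₂ / 2) + (B₁ + B₂ / 2)) (W ∩ {r | r / 2 + q ∈ W₂}) :=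
  fwdLogLipschitzOn_polarDensity₂ h₁ h₂ q (fwdLogLipschitzOn_ray₂_of_mul q hf₁ hf₂)

end Forward

/-! ## §4 Non-vacuity -/

section NonVacuity

/-- the presentation is junk-free: at the origin of `ℝ × ℝ`, `dilate₂ ∘ logPolar₂` is still the identity …
[folklore] -/
example : dilate₂ (logPolar₂ ((0 : ℝ), (0 : ℝ))) = (0, 0) := dilate₂_logPolar₂ _

/-- … and on the pure-toron axis `{a = 0}` of `ℝ² × ℝ²` (flat block switched off). [folklore] -/
example (w : EuclideanSpace ℝ (Fin 2)) :
    dilate₂ (logPolar₂ ((0 : EuclideanSpace ℝ (Fin 2)), w)) = (0, w) := dilate₂_logPolar₂ _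

/-- INSTANCE of the two-speed identity with both blocks one-dimensional (`n₁ = n₂ = 1`, fibre factor `e^{−(3/2) r}`,
transversal weight `e^{−q}`): a Gaussian flat weight times a QUARTIC harmonic weight `exp(−a² − w⁴)` (the toron
block's action starts at order four). [folklore] -/
example : (((volume : Measure ℝ).prod (volume : Measure ℝ)).withDensity
      fun x => ENNReal.ofReal (Real.exp (-x.1 ^ 2 - x.2 ^ 4))).map logPolar₂ =
    ((dirMeasure₂ (volume : Measure ℝ) (volume : Measure ℝ) 1).prod (volume : Measure ℝ)).withDensity
      (polarDensity₂ 1 1 fun x => ENNReal.ofReal (Real.exp (-x.1 ^ 2 - x.2 ^ 4))) := by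
  have h := map_logPolar₂_withDensity (volume : Measure ℝ) (volume : Measure ℝ)
    (f := fun x : ℝ × ℝ => ENNReal.ofReal (Real.exp (-x.1 ^ 2 - x.2 ^ 4))) (by fun_prop)
  simpa only [Module.finrank_self, Nat.cast_one] using h

/-- INSTANCE with a three-dimensional flat block and a two-dimensional harmonic block (`n₁ = 3`, `n₂ = 2`: fibre
factor `e^{−4 r}`, transversal weight `e^{−2 q}`), Gaussian weight. [folklore] -/
example : (((volume : Measure (EuclideanSpace ℝ (Fin 3))).prod (volume : Measure (EuclideanSpace ℝ (Fin 2)))).withDensity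
      fun x => ENNReal.ofReal (Real.exp (-‖x.1‖ ^ 2 - ‖x.2‖ ^ 2))).map logPolar₂ =
    ((dirMeasure₂ (volume : Measure (EuclideanSpace ℝ (Fin 3))) (volume : Measure (EuclideanSpace ℝ (Fin 2))) 2).prod
      (volume : Measure ℝ)).withDensity
      (polarDensity₂ 3 2 fun x => ENNReal.ofReal (Real.exp (-‖x.1‖ ^ 2 - ‖x.2‖ ^ 2))) := by
  have h := map_logPolar₂_withDensity (volume : Measure (EuclideanSpace ℝ (Fin 3)))
    (volume : Measure (EuclideanSpace ℝ (Fin 2)))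
    (f := fun x : EuclideanSpace ℝ (Fin 3) × EuclideanSpace ℝ (Fin 2) =>
      ENNReal.ofReal (Real.exp (-‖x.1‖ ^ 2 - ‖x.2‖ ^ 2))) (by fun_prop)
  simpa only [finrank_euclideanSpace_fin, Nat.cast_ofNat] using h

/-- NUMBERS: the exactly-log-Lipschitz weight `e^{−2 r}` (constant `2` in its own clock) read at half speed has
constant `2/2 = 1`; with `n₁ = 3`, `n₂ = 2` and blockwise ray constants `B₁ = 3/1000` (v1 §4, cubic criterion) and
`B₂ = 2`, the two-speed (DC-fwd) constant is `(3 + 2/2) + (3/1000 + 2/2) = 5003/1000`. [folklore] -/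
example (q : ℝ) : FwdLogLipschitzOn (fun r => ENNReal.ofReal (Real.exp (-(2 * (r / 2 + q))))) (2 / 2) univ :=
  fwdLogLipschitzOn_halfSpeed (fwdLogLipschitzOn_polarJacobian (le_refl (2 : ℝ)) univ) q fun _ _ => mem_univ _

/-- the arithmetic of the preceding docstring. [folklore] -/
example : ((3 : ℝ) + 2 / 2) + (3 / 1000 + 2 / 2) = 5003 / 1000 := by norm_num

end NonVacuity

end Literature.MathematicalPhysics.QuantumFieldTheory.Balaban1983to89.T4ShellMeasureTwoSpeed
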